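import Literature.AlgebraicGeometry.Morphisms.SectionsFlatBaseChange
import Literature.AlgebraicGeometry.Morphisms.CechModuleCoverIndependence
import Literature.AlgebraicGeometry.Morphisms.CechModuleUnit
import Mathlib.AlgebraicGeometry.Morphisms.Affine
import Mathlib.RingTheory.Flat.Basic
import HarnessLib

/-!
# Flat base change of Čech `Ȟ¹(𝒰, 𝒪_X)`: `H¹(X, 𝒪_X) = 0 ⇒ H¹(X ×_A B, 𝒪) = 0` for `A → B` flat

For a cartesian square of schemes over affine bases
```
      Z ──g──▶ X
   f_Z│        │f_X
      ▼        ▼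
   Spec B ──▶ Spec A
```
(`IsPullback g f_Z f_X (Spec (A → B))`) and a family of opens `𝒰 = (U_i)` of `X`, the Čech complex
of `𝒪_Z` on the preimage family `g⁻¹𝒰` (`Morphisms/CechH1`, `Morphisms/CechH1Pullback`) receives
the **base-change maps** `B ⊗_A Čᵖ(𝒰, 𝒪_X) → Čᵖ(g⁻¹𝒰, 𝒪_Z)`, `b ⊗ c ↦ f_Z^*(b) · g^*(c)`
(`bcC0`, `bcC1`, `bcC2`, built from `Morphisms/SectionsFlatBaseChange.bcPi`), commuting with the
differentials (`bcC1_lTensor_cechD0`, `bcC2_lTensor_cechD1`); for `𝒰` finite with affine members,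
`X` quasi-separated and `A → B` flat they are bijective in degrees `≤ 1` and injective in degree
`2` (`bcC1_bijective`, `bcC2_injective`: flat base change of `H⁰` on the quasi-compact
quasi-separated opens `U_i ∩ U_j`, `U_i ∩ U_j ∩ U_k`).  Consequences:

* `cechZ1_le_cechB1_preimageFamily_of_flat` — **if `Ȟ¹(𝒰, 𝒪_X) = 0` then `Ȟ¹(g⁻¹𝒰, 𝒪_Z) = 0`**:
  a cocycle on `g⁻¹𝒰` is `κ¹(T)` with `(1 ⊗ d¹) T = 0`, hence `T = (1 ⊗ d⁰) S` by flatness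
  (`Module.Flat.lTensor_exact` applied to the exact `Č⁰ → Č¹ → Č²`), hence a coboundary — the Čech
  form of FLAT BASE CHANGE OF COHOMOLOGY `H¹(X_B, 𝒪) = H¹(X, 𝒪) ⊗_A B` (The Stacks Project,
  Tag 02KH; EGA III₁ (1.4.15); Hartshorne III Prop. 9.3) in the vanishing case;
* `subsingleton_cechH1_of_isPullback_of_flat` — **for `X` quasi-compact quasi-separated with
  `Ȟ¹(𝒰, 𝒪_X) = 0` for every finite affine open cover `𝒰`, the base change `Z` has
  `Ȟ¹(𝒱, 𝒪_Z) = 0` for every finite affine open cover `𝒱`** (pull back one finite affine cover,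
  then independence of the affine cover on `Z`, `Morphisms/CechModuleCoverIndependence`).

This is the input "`H¹(Z, 𝒪_Z) = H¹(Y, 𝒪_Y) ⊗_A B = 0`" of Lipman 1969, Prop. (16.5) (rational
singularities ascend along flat local base change).  Everything is proved; no named facts.
Mathlib searched (pin v4.32): `Module.Flat.lTensor_exact`, `IsAffineOpen.preimage`,
`MorphismProperty.of_isPullback` for `@IsAffineHom`, `Scheme.Hom.iSup_preimage_eq_top` (used);
Mathlib has no Čech cohomology of schemes.

## References

* The Stacks Project, Tag 02KH (Cohomology of Schemes, Lemma 30.5.2: flat base change); Tag 01ED.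
  [StacksProject]
* A. Grothendieck, J. Dieudonné, EGA III₁ (Publ. Math. IHÉS 11, 1961), Prop. (1.4.15). [EGAIII1]
* R. Hartshorne, *Algebraic Geometry*, GTM 52 (1977), III Prop. 9.3. [Hartshorne1977]
-/

noncomputable section

open CategoryTheory AlgebraicGeometry Limits TopologicalSpace Opposite TensorProduct

universe u v

namespace Literature.AlgebraicGeometry.Morphisms

/-! ## Curried `Π`-types (linear bookkeeping) -/

section Curry

variable (A : Type u) [CommRing A] {ι : Type v}

/-- Curried double `Π`-types as single `Π`-types over pairs, `F ↦ ((i, j) ↦ F i j)` with inverse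
`G ↦ (i j ↦ G (i, j))` (linear bookkeeping). [folklore] -/
def cechPiCurry₂ (S : ι → ι → Type*) [∀ i j, AddCommMonoid (S i j)] [∀ i j, Module A (S i j)] :
    (∀ i j, S i j) ≃ₗ[A] ∀ p : ι × ι, S p.1 p.2 where
  toFun F p := F p.1 p.2
  invFun G i j := G (i, j)
  left_inv _ := rfl
  right_inv _ := rfl
  map_add' _ _ := rfl
  map_smul' _ _ := rfl

/-- Curried triple `Π`-types as single `Π`-types over triples, `F ↦ ((i, j, k) ↦ F i j k)` with
inverse `G ↦ (i j k ↦ G (i, j, k))` (linear bookkeeping). [folklore] -/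
def cechPiCurry₃ (S : ι → ι → ι → Type*) [∀ i j k, AddCommMonoid (S i j k)]
    [∀ i j k, Module A (S i j k)] :
    (∀ i j k, S i j k) ≃ₗ[A] ∀ p : ι × ι × ι, S p.1 p.2.1 p.2.2 where
  toFun F p := F p.1 p.2.1 p.2.2
  invFun G i j k := G (i, j, k)
  left_inv _ := rfl
  right_inv _ := rfl
  map_add' _ _ := rfl
  map_smul' _ _ := rfl

end Curry

variable {A B : Type u} [CommRing A] [CommRing B] [Algebra A B] {X Z : Scheme.{u}}
  (fX : X ⟶ Spec (.of A)) (fZ : Z ⟶ Spec (.of B)) (g : Z ⟶ X)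
  (hg : g ≫ fX = restrictBase A fZ) {ι : Type v} (U : ι → X.Opens)

/-! ## Base change of Čech cochains -/

section Cochains

/-- `g⁻¹U_i ∩ g⁻¹U_j ⊆ g⁻¹(U_i ∩ U_j)` (private plumbing). [folklore] -/
private theorem preimageFamily_inf_le (i j : ι) :
    preimageFamily g U i ⊓ preimageFamily g U j ≤ g ⁻¹ᵁ (U i ⊓ U j) :=
  fun _ hx => hx

/-- `g⁻¹U_i ∩ g⁻¹U_j ∩ g⁻¹U_k ⊆ g⁻¹(U_i ∩ U_j ∩ U_k)` (private plumbing). [folklore] -/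
private theorem preimageFamily_inf₃_le (i j k : ι) :
    preimageFamily g U i ⊓ preimageFamily g U j ⊓ preimageFamily g U k ≤
      g ⁻¹ᵁ (U i ⊓ U j ⊓ U k) :=
  fun _ hx => hx

/-- The structure maps `B → Γ(Z, W)` are compatible with restriction (`B`-linearity of the
restriction maps of `𝒪_Z`; private plumbing). [folklore] -/
private theorem res_toSectionsBase' {W W' : Z.Opens} (h : W' ≤ W) (b : B) :
    Sections.res (restrictBase A fZ) h (toSectionsBase A fZ W b) = toSectionsBase A fZ W' b :=
  (Sections.res fZ h).commutes b

/-- **Base change of `0`-cochains** `B ⊗_A Č⁰(𝒰, 𝒪_X) → Č⁰(g⁻¹𝒰, 𝒪_Z)`: on pure tensors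
`b ⊗ (e_i)_i ↦ (f_Z^*(b)|_{g⁻¹U_i} · g^*(e_i))_i`. [cite: StacksProject, Tag 02KH] -/
def bcC0 : B ⊗[A] CechC0 fX U →ₗ[A] CechC0 (restrictBase A fZ) (preimageFamily g U) :=
  bcPi fX fZ g hg U (preimageFamily g U) fun _ => le_rfl

/-- **Base change of `1`-cochains** `B ⊗_A Č¹(𝒰, 𝒪_X) → Č¹(g⁻¹𝒰, 𝒪_Z)`: on pure tensors
`b ⊗ (c_{ij})_{ij} ↦ (f_Z^*(b)|_{g⁻¹U_i ∩ g⁻¹U_j} · g^*(c_{ij}))_{ij}`.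
[cite: StacksProject, Tag 02KH] -/
def bcC1 : B ⊗[A] CechC1 fX U →ₗ[A] CechC1 (restrictBase A fZ) (preimageFamily g U) :=
  (cechPiCurry₂ A (fun i j => Sections (restrictBase A fZ)
      (preimageFamily g U i ⊓ preimageFamily g U j))).symm.toLinearMap ∘ₗ
    bcPi fX fZ g hg (fun p : ι × ι => U p.1 ⊓ U p.2)
      (fun p => preimageFamily g U p.1 ⊓ preimageFamily g U p.2)
      (fun p => preimageFamily_inf_le g U p.1 p.2) ∘ₗ
    LinearMap.lTensor B (cechPiCurry₂ A (fun i j => Sections fX (U i ⊓ U j))).toLinearMap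

/-- **Base change of `2`-cochains** `B ⊗_A Č²(𝒰, 𝒪_X) → Č²(g⁻¹𝒰, 𝒪_Z)`: on pure tensors
`b ⊗ (c_{ijk})_{ijk} ↦ (f_Z^*(b)|_{g⁻¹U_i ∩ g⁻¹U_j ∩ g⁻¹U_k} · g^*(c_{ijk}))_{ijk}`.
[cite: StacksProject, Tag 02KH] -/
def bcC2 : B ⊗[A] CechC2 fX U →ₗ[A] CechC2 (restrictBase A fZ) (preimageFamily g U) :=
  (cechPiCurry₃ A (fun i j k => Sections (restrictBase A fZ)
      (preimageFamily g U i ⊓ preimageFamily g U j ⊓ preimageFamily g U k))).symm.toLinearMap ∘ₗ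
    bcPi fX fZ g hg (fun p : ι × ι × ι => U p.1 ⊓ U p.2.1 ⊓ U p.2.2)
      (fun p => preimageFamily g U p.1 ⊓ preimageFamily g U p.2.1 ⊓ preimageFamily g U p.2.2)
      (fun p => preimageFamily_inf₃_le g U p.1 p.2.1 p.2.2) ∘ₗ
    LinearMap.lTensor B
      (cechPiCurry₃ A (fun i j k => Sections fX (U i ⊓ U j ⊓ U k))).toLinearMap

/-- `bcC0 (b ⊗ e)_i = f_Z^*(b) · g^*(e_i)` (unfolding; private). [folklore] -/
private theorem bcC0_tmul (b : B) (e : CechC0 fX U) (i : ι) :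
    bcC0 fX fZ g hg U (b ⊗ₜ e) i =
      toSectionsBase A fZ _ b * Sections.comap fX (restrictBase A fZ) g hg le_rfl (e i) :=
  rfl

/-- `bcC1 (b ⊗ c)_{ij} = f_Z^*(b) · g^*(c_{ij})` (unfolding; private). [folklore] -/
private theorem bcC1_tmul (b : B) (c : CechC1 fX U) (i j : ι) :
    bcC1 fX fZ g hg U (b ⊗ₜ c) i j =
      toSectionsBase A fZ _ b *
        Sections.comap fX (restrictBase A fZ) g hg (preimageFamily_inf_le g U i j) (c i j) :=
  rfl

/-- `bcC2 (b ⊗ c)_{ijk} = f_Z^*(b) · g^*(c_{ijk})` (unfolding; private). [folklore] -/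
private theorem bcC2_tmul (b : B) (c : CechC2 fX U) (i j k : ι) :
    bcC2 fX fZ g hg U (b ⊗ₜ c) i j k =
      toSectionsBase A fZ _ b *
        Sections.comap fX (restrictBase A fZ) g hg (preimageFamily_inf₃_le g U i j k) (c i j k) :=
  rfl

/-- **Base change commutes with `d⁰`**: the base-change maps form a morphism of complexes
`B ⊗_A Č•(𝒰, 𝒪_X) → Č•(g⁻¹𝒰, 𝒪_Z)` (the identification of the Čech complex of the base change in
the proof of flat base change).
[cite: StacksProject, Tag 02KH (proof: Čech complex of the base change)] -/
theorem bcC1_lTensor_cechD0 (T : B ⊗[A] CechC0 fX U) :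
    bcC1 fX fZ g hg U (LinearMap.lTensor B (cechD0 fX U) T) =
      cechD0 (restrictBase A fZ) (preimageFamily g U) (bcC0 fX fZ g hg U T) := by
  induction T using TensorProduct.induction_on with
  | zero => simp only [map_zero]
  | tmul b e =>
      funext i j
      rw [LinearMap.lTensor_tmul, bcC1_tmul, cechD0_apply, cechD0_apply, bcC0_tmul, bcC0_tmul,
        map_sub, map_mul, map_mul, mul_sub, res_toSectionsBase', res_toSectionsBase',
        Sections.res_comap, Sections.res_comap, Sections.comap_res, Sections.comap_res]
  | add x y hx hy => simp only [map_add, hx, hy]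

/-- **Base change commutes with `d¹`** (second square of the morphism of complexes
`B ⊗_A Č•(𝒰, 𝒪_X) → Č•(g⁻¹𝒰, 𝒪_Z)`).
[cite: StacksProject, Tag 02KH (proof: Čech complex of the base change)] -/
theorem bcC2_lTensor_cechD1 (T : B ⊗[A] CechC1 fX U) :
    bcC2 fX fZ g hg U (LinearMap.lTensor B (cechD1 fX U) T) =
      cechD1 (restrictBase A fZ) (preimageFamily g U) (bcC1 fX fZ g hg U T) := by
  induction T using TensorProduct.induction_on with
  | zero => simp only [map_zero]
  | tmul b c =>
      funext i j k
      rw [LinearMap.lTensor_tmul, bcC2_tmul, cechD1_apply, cechD1_apply, bcC1_tmul, bcC1_tmul,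
        bcC1_tmul, map_add, map_sub, map_mul, map_mul, map_mul, mul_add, mul_sub,
        res_toSectionsBase', res_toSectionsBase', res_toSectionsBase', Sections.res_comap,
        Sections.res_comap, Sections.res_comap, Sections.comap_res, Sections.comap_res,
        Sections.comap_res]
  | add x y hx hy => simp only [map_add, hx, hy]

/-- Intersections of two quasi-compact opens of a quasi-separated scheme are quasi-compact
(private). [folklore] -/
private theorem isCompact_inf_of_quasiSeparatedSpace [QuasiSeparatedSpace X] {W₁ W₂ : X.Opens}
    (h₁ : IsCompact (W₁ : Set X)) (h₂ : IsCompact (W₂ : Set X)) :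
    IsCompact ((W₁ ⊓ W₂ : X.Opens) : Set X) :=
  isQuasiSeparated_univ _ _ (Set.subset_univ _) W₁.isOpen h₁ (Set.subset_univ _) W₂.isOpen h₂

/-- **`B ⊗_A Č¹(𝒰) → Č¹(g⁻¹𝒰)` is bijective** (`𝒰` finite with affine members, `X`
quasi-separated, `A → B` flat). [cite: StacksProject, Tag 02KH] -/
theorem bcC1_bijective [Finite ι] [QuasiSeparatedSpace X] [Module.Flat A B]
    (H : IsPullback g fZ fX (Spec.map (CommRingCat.ofHom (algebraMap A B))))
    (hU : ∀ i, IsAffineOpen (U i)) : Function.Bijective (bcC1 fX fZ g H.w U) := by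
  refine (LinearEquiv.bijective (cechPiCurry₂ A (fun i j => Sections (restrictBase A fZ)
      (preimageFamily g U i ⊓ preimageFamily g U j))).symm).comp
    ((bcPi_bijective fX fZ g (fun p : ι × ι => U p.1 ⊓ U p.2)
      (fun p => preimageFamily g U p.1 ⊓ preimageFamily g U p.2)
      (fun p => preimageFamily_inf_le g U p.1 p.2) H
      (fun p => isCompact_inf_of_quasiSeparatedSpace (hU p.1).isCompact (hU p.2).isCompact)
      (fun p => isQuasiSeparated_univ.of_subset (Set.subset_univ _))
      (fun p _ hx => hx)).comp
    (LinearEquiv.bijective (LinearEquiv.lTensor B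
      (cechPiCurry₂ A (fun i j => Sections fX (U i ⊓ U j))))))

/-- **`B ⊗_A Č²(𝒰) → Č²(g⁻¹𝒰)` is injective** (indeed bijective; same hypotheses).
[cite: StacksProject, Tag 02KH] -/
theorem bcC2_injective [Finite ι] [QuasiSeparatedSpace X] [Module.Flat A B]
    (H : IsPullback g fZ fX (Spec.map (CommRingCat.ofHom (algebraMap A B))))
    (hU : ∀ i, IsAffineOpen (U i)) : Function.Injective (bcC2 fX fZ g H.w U) := by
  refine (LinearEquiv.injective (cechPiCurry₃ A (fun i j k => Sections (restrictBase A fZ)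
      (preimageFamily g U i ⊓ preimageFamily g U j ⊓ preimageFamily g U k))).symm).comp
    ((bcPi_bijective fX fZ g (fun p : ι × ι × ι => U p.1 ⊓ U p.2.1 ⊓ U p.2.2)
      (fun p => preimageFamily g U p.1 ⊓ preimageFamily g U p.2.1 ⊓ preimageFamily g U p.2.2)
      (fun p => preimageFamily_inf₃_le g U p.1 p.2.1 p.2.2) H
      (fun p => isCompact_inf_of_quasiSeparatedSpace
        (isCompact_inf_of_quasiSeparatedSpace (hU p.1).isCompact (hU p.2.1).isCompact)
        (hU p.2.2).isCompact)
      (fun p => isQuasiSeparated_univ.of_subset (Set.subset_univ _))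
      (fun p _ hx => hx)).1.comp
    (LinearEquiv.injective (LinearEquiv.lTensor B
      (cechPiCurry₃ A (fun i j k => Sections fX (U i ⊓ U j ⊓ U k))))))

end Cochains

/-! ## `Ȟ¹(𝒰, 𝒪_X) = 0 ⇒ Ȟ¹(g⁻¹𝒰, 𝒪_Z) = 0` -/

section H1

/-- `Č⁰ → Č¹ → Č²` is exact when `Ȟ¹(𝒰, 𝒪_X) = 0` (private). [folklore] -/
private theorem exact_cechD0_cechD1_of_le (h : cechZ1 fX U ≤ cechB1 fX U) :
    Function.Exact (cechD0 fX U) (cechD1 fX U) := by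
  rw [LinearMap.exact_iff]
  exact le_antisymm h (cechB1_le_cechZ1 fX U)

/-- **Flat base change of `Ȟ¹` in the vanishing case**: for the cartesian square
`Z = X ×_{Spec A} Spec B` with `A → B` flat, `X` quasi-separated and `𝒰` a finite family of affine
opens of `X`, if every Čech `1`-cocycle of `𝒪_X` on `𝒰` is a coboundary then every Čech `1`-cocycle
of `𝒪_Z` on `g⁻¹𝒰` is a coboundary (`Ȟ¹(g⁻¹𝒰, 𝒪_Z) = Ȟ¹(𝒰, 𝒪_X) ⊗_A B = 0`).
[cite: StacksProject, Tag 02KH (Cohomology of Schemes, Lemma 30.5.2: flat base change)] -/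
theorem cechZ1_le_cechB1_preimageFamily_of_flat [Finite ι] [QuasiSeparatedSpace X]
    [Module.Flat A B] (H : IsPullback g fZ fX (Spec.map (CommRingCat.ofHom (algebraMap A B))))
    (hU : ∀ i, IsAffineOpen (U i)) (h : cechZ1 fX U ≤ cechB1 fX U) :
    cechZ1 (restrictBase A fZ) (preimageFamily g U) ≤
      cechB1 (restrictBase A fZ) (preimageFamily g U) := by
  intro z hz
  obtain ⟨T, rfl⟩ := (bcC1_bijective fX fZ g U H hU).2 z
  have hT : LinearMap.lTensor B (cechD1 fX U) T = 0 := by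
    apply bcC2_injective fX fZ g U H hU
    rw [bcC2_lTensor_cechD1, map_zero]
    exact (mem_cechZ1_iff _ _ _).mp hz
  obtain ⟨S, hS⟩ := (Module.Flat.lTensor_exact B (exact_cechD0_cechD1_of_le fX U h) T).mp hT
  rw [mem_cechB1_iff]
  exact ⟨bcC0 fX fZ g H.w U S, by rw [← bcC1_lTensor_cechD0, hS]⟩

/-- The same with the classes: `Ȟ¹(𝒰, 𝒪_X) = 0 ⇒ Ȟ¹(g⁻¹𝒰, 𝒪_Z) = 0`.
[cite: StacksProject, Tag 02KH (Cohomology of Schemes, Lemma 30.5.2: flat base change)] -/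
theorem subsingleton_cechH1_preimageFamily_of_flat [Finite ι] [QuasiSeparatedSpace X]
    [Module.Flat A B] (H : IsPullback g fZ fX (Spec.map (CommRingCat.ofHom (algebraMap A B))))
    (hU : ∀ i, IsAffineOpen (U i)) (h : Subsingleton (CechH1 fX U)) :
    Subsingleton (CechH1 (restrictBase A fZ) (preimageFamily g U)) := by
  rw [Submodule.Quotient.subsingleton_iff, eq_top_iff] at h ⊢
  rintro z -
  exact cechZ1_le_cechB1_preimageFamily_of_flat fX fZ g U H hU
    (fun c hc => h (x := ⟨c, hc⟩) trivial) z.2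

end H1

/-! ## All finite affine covers of the base change -/

section Covers

/-- A quasi-compact scheme has a finite affine open cover indexed in its own universe
(private). [folklore] -/
private theorem exists_finite_isAffineOpen_cover (X : Scheme.{u}) [CompactSpace X] :
    ∃ (ι : Type u) (_ : Finite ι) (U : ι → X.Opens), (∀ i, IsAffineOpen (U i)) ∧ ⨆ i, U i = ⊤ := by
  obtain ⟨s, hs, e⟩ := (isCompact_iff_finite_and_eq_biUnion_affineOpens (U := (⊤ : X.Opens))).mp
    (by simpa using isCompact_univ)
  haveI := hs.to_subtype
  refine ⟨s, inferInstance, fun i => i.1.1, fun i => i.1.2, ?_⟩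
  rw [iSup_subtype]
  exact e.symm

/-- **`H¹ = 0` ascends along flat base change**: for the cartesian square `Z = X ×_{Spec A} Spec B`
with `A → B` flat and `X` quasi-compact and quasi-separated, if `Ȟ¹(𝒰, 𝒪_X) = 0` for every finite
affine open cover `𝒰` of `X` then `Ȟ¹(𝒱, 𝒪_Z) = 0` for every finite affine open cover `𝒱` of `Z`
(`Ȟ¹` for the `B`-structure `f_Z`; pull back a finite affine cover of `X` — its members are affine
since `g` is an affine morphism — apply `subsingleton_cechH1_preimageFamily_of_flat`, then the
independence of the affine cover on `Z`, `subsingleton_cechMH1_iff_of_isAffineOpen` for `𝒪_Z`).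
[cite: StacksProject, Tag 02KH (Cohomology of Schemes, Lemma 30.5.2: flat base change)] -/
theorem subsingleton_cechH1_of_isPullback_of_flat [CompactSpace X] [QuasiSeparatedSpace X]
    [Module.Flat A B] (H : IsPullback g fZ fX (Spec.map (CommRingCat.ofHom (algebraMap A B))))
    (hX : ∀ (ι : Type u) [Finite ι] (U : ι → X.Opens),
      (∀ i, IsAffineOpen (U i)) → ⨆ i, U i = ⊤ → Subsingleton (CechH1 fX U))
    {ι : Type v} [Finite ι] (V : ι → Z.Opens) (hV : ∀ i, IsAffineOpen (V i))
    (hVcov : ⨆ i, V i = ⊤) : Subsingleton (CechH1 fZ V) := by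
  obtain ⟨κ, _, U, hU, hUcov⟩ := exists_finite_isAffineOpen_cover X
  -- `g` is affine (base change of `Spec B → Spec A`), so `g⁻¹U_i` is affine
  haveI : IsAffineHom g :=
    MorphismProperty.of_isPullback (P := @IsAffineHom) H.flip inferInstance
  have hU' : ∀ i, IsAffineOpen (preimageFamily g U i) := fun i => (hU i).preimage g
  have hU'cov : ⨆ i, preimageFamily g U i = ⊤ := g.iSup_preimage_eq_top hUcov
  have h0 : Subsingleton (CechH1 (restrictBase A fZ) (preimageFamily g U)) :=
    subsingleton_cechH1_preimageFamily_of_flat fX fZ g U H hU (hX κ U hU hUcov)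
  -- independence of the affine cover (for `𝒪_Z` as a sheaf of modules), over the base `A`
  have h1 : Subsingleton (CechH1 (restrictBase A fZ) V) := by
    have h0' : Subsingleton (CechMH1 (restrictBase A fZ) (SheafOfModules.unit Z.ringCatSheaf)
        (preimageFamily g U)) := by rwa [CechMH1_unit]
    have h1' := (subsingleton_cechMH1_iff_of_isAffineOpen (restrictBase A fZ)
      Literature.AlgebraicGeometry.Modules.IsAffineLocalizing.unit (preimageFamily g U) V hU' hV
      hU'cov hVcov).mp h0'
    rwa [CechMH1_unit] at h1'
  -- the base ring does not matter
  exact h1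

end Covers

end Literature.AlgebraicGeometry.Morphisms

end
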